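import Summits.QuantumAdvantage.QuantumAdvantage.Theorems.CubicForrelationNearExactIsExactFibreAverage
import Summits.QuantumAdvantage.QuantumAdvantage.Theorems.CubicForrelationNearExactIsExactDerivDegree
import Summits.QuantumAdvantage.QuantumAdvantage.Theorems.CubicForrelationNearExactIsExactRmWeight
import Summits.QuantumAdvantage.QuantumAdvantage.Theorems.CubicForrelationNearExactIsExactMmFormCeilingA
import Literature.Computability.QuantumComplexity.ForrelationSignTransport

/-!
# `NearExactIsExact` (stmt-QuantumAdvantage-14043), line `direct-sum-amplification` — template rigidity (TR)

Stub `stub_templateRigidity` of the line `direct-sum-amplification` for the crux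
`Summit.QuantumAdvantage.QuantumAdvantage.Theses.CubicForrelation.NearExactIsExact`.

**What.** A TEMPLATE on `s + s + k` bits is a Boolean function `g(y′ ‖ u ‖ w)` in the sign form
`(-1)^{g(y′ ‖ u ‖ w)} = (-1)^{y′·u} (-1)^{G_u(w)}` for an arbitrary family `G : 𝔽₂^s → (𝔽₂^k → 𝔽₂)`.
If `f` is CUBIC and `Φ(f, g) > 31/32`, then `f` is a MATCHED PARTNER of the template:
`(-1)^{f(a ‖ b ‖ c)} = (-1)^{a·b} (-1)^{F_a(c)}` with `F_a(c) = f(a ‖ 0 ‖ c)` (`stub_templateRigidity`).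

**Proof.**
* Localisation (`trg_fsum`): summing the dual variable `y = y′ ‖ u ‖ w` over the linear block `y′` pins
  `u = a` (`fa_inner_sum`), so `∑_{x,y} (-1)^{f(x)} (-1)^{x·y} (-1)^{g(y)} = 2^s ∑_{a,c} S(a,c) V(a,c)` with
  `S(a,c) = ∑_b (-1)^{f(a ‖ b ‖ c)} (-1)^{b·a}` and `V(a,c) = ∑_w (-1)^{c·w} (-1)^{G_a(w)} = W_{G_a}(c)`.
* Parseval (`trg_parseval`, from `DerivativeWalsh.sum_W_sq`): `∑_c V(a,c)² = 4^k`; Cauchy–Schwarz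
  (`trg_cauchy_schwarz`): `(∑ S V)² ≤ (∑ S²)(∑ V²)`.
* The fibre function `q_{a,c}(b) = f(a ‖ b ‖ c) ⊕ ℓ_a(b)` (`ℓ_a` the linear form with `(-1)^{ℓ_a(b)} = (-1)^{b·a}`,
  `fc_linForm_exists`) is cubic in `b`; if it takes both values, `|S(a,c)| ≤ (3/4) 2^s` (Reed–Muller weight,
  `fc_bias` fed with `stub_rmWeight stub_derivDegree`), else `|S(a,c)| ≤ 2^s`.
* The `b`-derivatives `ψᵢ(a ‖ b ‖ c) = f(a ‖ b ‖ c) ⊕ f(a ‖ b ⊕ eᵢ ‖ c) ⊕ aᵢ` have degree `≤ 2` on `2s + k` bits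
  (`stub_derivDegree`) and `q_{a,c}(b) ⊕ q_{a,c}(b ⊕ eᵢ) = ψᵢ(a ‖ b ‖ c)`. If some `ψᵢ ≢ 0` it has weight
  `≥ 2^{2s+k}/4` (`stub_rmWeight`), so (`trg_count`) at least `2^{s+k}/4` pairs `(a,c)` carry a non-constant
  fibre, whence `∑ S² ≤ (57/64) 2^{3s+k}` and `Φ² ≤ 57/64 < (31/32)²` (`trg_core`) — contradiction.
* Hence every `ψᵢ ≡ 0`, every fibre function is invariant under all coordinate flips, hence constant
  (`fc_const_of_shift`), which is the matched form with `F_a(c) = f(a ‖ 0 ‖ c)`.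

References (orientation only; everything here is proved): S. Aaronson, A. Ambainis, Forrelation, SIAM J.
Comput. 47 (2018), §1.1.1; C. Carlet, Boolean Functions for Cryptography and Coding Theory (CUP 2020), §2.2 and
§4.1 Thm 7 (derivatives, Reed–Muller weights); R. O'Donnell, Analysis of Boolean Functions (2014), §1.4.
-/

noncomputable section

set_option linter.dupNamespace false -- D-0017: single-problem summit

namespace Summit.QuantumAdvantage.QuantumAdvantage.Theorems.CubicForrelation.NearExactIsExact

open Finset
open Literature.Computability.QuantumComplexity
open Literature.Computability.QuantumComplexity.BuzetChailloux (bxor zeroVec signOf_sq bxor_zeroVec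
  twist_zeroVec_right)
open Literature.Computability.QuantumComplexity.DerivativeWalsh (W sum_W_sq)

variable {s k : ℕ}

/-! ### Localisation, Parseval, Cauchy–Schwarz -/

/-- **Localisation of the forrelation sum of a template.** Under the sign form
`(-1)^{g(y′ ‖ u ‖ w)} = (-1)^{y′·u} (-1)^{G_u(w)}`, for every `f`,
`∑_{x,y} (-1)^{f(x)} (-1)^{x·y} (-1)^{g(y)} = 2^s ∑_a ∑_c S(a,c) V(a,c)` with
`S(a,c) = ∑_b (-1)^{f(a ‖ b ‖ c)} (-1)^{b·a}` and `V(a,c) = ∑_w (-1)^{c·w} (-1)^{G_a(w)}` (the `y′`-sum pins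
`u = a`: `fa_inner_sum`). [folklore] -/
theorem trg_fsum (f g : (Fin (s + s + k) → Bool) → Bool) (G : (Fin s → Bool) → (Fin k → Bool) → Bool)
    (hg : ∀ (y u : Fin s → Bool) (w : Fin k → Bool),
      signOf (g (Fin.append (Fin.append y u) w)) = twist y u * signOf (G u w))
    (S V : (Fin s → Bool) → (Fin k → Bool) → ℝ)
    (hS : ∀ a c, S a c = ∑ b : Fin s → Bool, signOf (f (Fin.append (Fin.append a b) c)) * twist b a)
    (hV : ∀ a c, V a c = ∑ w : Fin k → Bool, twist c w * signOf (G a w)) :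
    ∑ x : Fin (s + s + k) → Bool, ∑ y : Fin (s + s + k) → Bool, signOf (f x) * twist x y * signOf (g y) =
      (2 : ℝ) ^ s * ∑ a : Fin s → Bool, ∑ c : Fin k → Bool, S a c * V a c := by
  rw [sum_append (n₁ := s + s) (n₂ := k), sum_append (n₁ := s) (n₂ := s)]
  have e : ∀ (a b : Fin s → Bool) (c : Fin k → Bool),
      ∑ y : Fin (s + s + k) → Bool, signOf (f (Fin.append (Fin.append a b) c)) *
          twist (Fin.append (Fin.append a b) c) y * signOf (g y) =
        (2 : ℝ) ^ s * (signOf (f (Fin.append (Fin.append a b) c)) * twist b a * V a c) := by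
    intro a b c
    rw [fa_inner_sum g G hg, hV]
    simp only [mul_sum]
    exact sum_congr rfl fun w _ => by ring
  simp_rw [e]
  rw [mul_sum]
  refine sum_congr rfl fun a _ => ?_
  rw [sum_comm, mul_sum]
  refine sum_congr rfl fun c _ => ?_
  rw [hS, sum_mul, mul_sum]

/-- **Parseval on a fibre**: `∑_c (∑_w (-1)^{c·w} (-1)^{G_a(w)})² = 2^k · 2^k` (`sum_W_sq` for the `±1`-valued
function `w ↦ (-1)^{G_a(w)}`). [cite: ODonnell2014, §1.4] -/
theorem trg_parseval (G : (Fin s → Bool) → (Fin k → Bool) → Bool) (a : Fin s → Bool) :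
    ∑ c : Fin k → Bool, (∑ w : Fin k → Bool, twist c w * signOf (G a w)) ^ 2 = (2 : ℝ) ^ k * (2 : ℝ) ^ k := by
  have e : ∀ c : Fin k → Bool, ∑ w : Fin k → Bool, twist c w * signOf (G a w) = W (fun w => signOf (G a w)) c := by
    intro c
    rw [W]
    exact sum_congr rfl fun w _ => by rw [twist_comm, mul_comm]
  rw [sum_congr rfl fun c _ => by rw [e c], sum_W_sq, sum_congr rfl fun w _ => signOf_sq (G a w), sum_const,
    card_univ, Fintype.card_fun, Fintype.card_bool, Fintype.card_fin, nsmul_eq_mul, mul_one]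
  push_cast
  rfl

/-- **Cauchy–Schwarz for a double sum**: `(∑_{a,c} S V)² ≤ (∑_{a,c} S²) (∑_{a,c} V²)`. [folklore] -/
theorem trg_cauchy_schwarz {α γ : Type*} [Fintype α] [Fintype γ] (S V : α → γ → ℝ) :
    (∑ a, ∑ c, S a c * V a c) ^ 2 ≤ (∑ a, ∑ c, S a c ^ 2) * ∑ a, ∑ c, V a c ^ 2 := by
  have h1 : ∑ a, ∑ c, S a c * V a c = ∑ p : α × γ, S p.1 p.2 * V p.1 p.2 :=
    (Fintype.sum_prod_type' fun a c => S a c * V a c).symm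
  have h2 : ∑ a, ∑ c, S a c ^ 2 = ∑ p : α × γ, S p.1 p.2 ^ 2 := (Fintype.sum_prod_type' fun a c => S a c ^ 2).symm
  have h3 : ∑ a, ∑ c, V a c ^ 2 = ∑ p : α × γ, V p.1 p.2 ^ 2 := (Fintype.sum_prod_type' fun a c => V a c ^ 2).symm
  rw [h1, h2, h3]
  exact sum_mul_sq_le_sq_mul_sq univ _ _

/-! ### Fibre biases and the projection count -/

/-- `a ⊕ b = 1` on `Bool`: one of `a, b` is set and one is clear. [folklore] -/
theorem trg_both_of_xor : ∀ a b : Bool, (a ^^ b) = true → (a = true ∨ b = true) ∧ (a = false ∨ b = false) := by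
  decide

/-- The trivial bias bound, squared: `(∑_b (-1)^{Q b})² ≤ 4^s`. [folklore] -/
theorem trg_sq_le (Q : (Fin s → Bool) → Bool) : (∑ b, signOf (Q b)) ^ 2 ≤ (2 : ℝ) ^ s * (2 : ℝ) ^ s := by
  have h := abs_le.1 (fc_abs_sum_signOf_le Q)
  nlinarith [h.1, h.2]

/-- The bias of a NON-CONSTANT cubic, squared: `(∑_b (-1)^{Q b})² ≤ (9/16) 4^s` (Reed–Muller minimum weight,
hypothesis `hR` = `stub_rmWeight stub_derivDegree`, through `fc_bias`). [cite: Carlet2020, §4.1 Thm 7] -/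
theorem trg_sq_le_of_nonconst
    (hR : ∀ (m d : ℕ) (e : (Fin m → Bool) → Bool), IsDegLeFun d e → (∃ x, e x = true) →
      2 ^ m ≤ 2 ^ d * (univ.filter fun x => e x = true).card)
    {Q : (Fin s → Bool) → Bool} (hQ : IsDegLeFun 3 Q) (h1 : ∃ x, Q x = true) (h0 : ∃ x, Q x = false) :
    (∑ b, signOf (Q b)) ^ 2 ≤ 9 / 16 * ((2 : ℝ) ^ s * (2 : ℝ) ^ s) := by
  have h := abs_le.1 (fc_bias hR hQ h1 h0)
  nlinarith [h.1, h.2]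

/-- **Projection count.** If `β(a,c) ≥ 1` whenever the fibre over `(a,c)` contains a point of `{ψ = 1}` (and
`β ≥ 0`), then `#{x : ψ x = 1} ≤ 2^s ∑_a ∑_c β(a,c)` (each fibre has `2^s` points). [folklore] -/
theorem trg_count (ψ : (Fin (s + s + k) → Bool) → Bool) (β : (Fin s → Bool) → (Fin k → Bool) → ℝ)
    (hβ1 : ∀ (a b : Fin s → Bool) (c : Fin k → Bool), ψ (Fin.append (Fin.append a b) c) = true → 1 ≤ β a c)
    (hβ0 : ∀ a c, 0 ≤ β a c) :
    ((univ.filter fun x => ψ x = true).card : ℝ) ≤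
      (2 : ℝ) ^ s * ∑ a : Fin s → Bool, ∑ c : Fin k → Bool, β a c := by
  have e : ((univ.filter fun x => ψ x = true).card : ℝ) =
      ∑ x : Fin (s + s + k) → Bool, (if ψ x = true then (1 : ℝ) else 0) := by
    rw [Finset.sum_boole]
  rw [e, sum_append (n₁ := s + s) (n₂ := k), sum_append (n₁ := s) (n₂ := s), mul_sum]
  refine sum_le_sum fun a _ => ?_
  calc ∑ b : Fin s → Bool, ∑ c : Fin k → Bool,
        (if ψ (Fin.append (Fin.append a b) c) = true then (1 : ℝ) else 0)
      ≤ ∑ _b : Fin s → Bool, ∑ c : Fin k → Bool, β a c := by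
        refine sum_le_sum fun b _ => sum_le_sum fun c _ => ?_
        split_ifs with h
        · exact hβ1 a b c h
        · exact hβ0 a c
    _ = (2 : ℝ) ^ s * ∑ c : Fin k → Bool, β a c := by
        rw [sum_const, card_univ, Fintype.card_fun, Fintype.card_bool, Fintype.card_fin, nsmul_eq_mul]
        push_cast
        rfl

/-! ### The analytic core: `Φ > 31/32` forces fewer than a quarter of the fibres to be non-constant -/

/-- **Analytic core.** With `S, V` as in `trg_fsum`, Parseval `∑_c V(a,c)² = 4^k`, the fibre bounds
`S(a,c)² ≤ 4^s (1 − (7/16) β(a,c))` and at least a quarter of bad fibres (`2^{s+k} ≤ 4 ∑ β`), the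
unnormalised sum `T = 2^s ∑ S V` has `T² ≤ (57/64) 2^{3(2s+k)} < (31/32)² 2^{3(2s+k)}`, so `Φ = T/√(2^{3(2s+k)})`
cannot exceed `31/32`. [folklore] -/
theorem trg_core (S V β : (Fin s → Bool) → (Fin k → Bool) → ℝ) (T : ℝ)
    (hV : ∀ a, ∑ c, V a c ^ 2 = (2 : ℝ) ^ k * (2 : ℝ) ^ k)
    (hS : ∀ a c, S a c ^ 2 ≤ (2 : ℝ) ^ s * (2 : ℝ) ^ s - 7 / 16 * ((2 : ℝ) ^ s * (2 : ℝ) ^ s) * β a c)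
    (hβ : (2 : ℝ) ^ s * (2 : ℝ) ^ k ≤ 4 * ∑ a, ∑ c, β a c)
    (hT : T = (2 : ℝ) ^ s * ∑ a, ∑ c, S a c * V a c)
    (hΦ : 31 / 32 < (Real.sqrt ((2 : ℝ) ^ (3 * (s + s + k))))⁻¹ * T) : False := by
  have hP : (0 : ℝ) < 2 ^ s := by positivity
  have hK : (0 : ℝ) < 2 ^ k := by positivity
  have hM0 : (0 : ℝ) ≤ (2 : ℝ) ^ (3 * (s + s + k)) := by positivity
  have hR0 : 0 < Real.sqrt ((2 : ℝ) ^ (3 * (s + s + k))) := Real.sqrt_pos.2 (by positivity)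
  -- the hypothesis `Φ > 31/32`, squared
  have h1 : 31 / 32 * Real.sqrt ((2 : ℝ) ^ (3 * (s + s + k))) < T := by
    have h := mul_lt_mul_of_pos_left hΦ hR0
    rw [mul_inv_cancel_left₀ hR0.ne'] at h
    linarith
  have h2 : (31 / 32) ^ 2 * ((2 : ℝ) ^ s * 2 ^ s * 2 ^ k) ^ 3 < T ^ 2 := by
    have hsq := mul_self_lt_mul_self (by positivity) h1
    have hM : Real.sqrt ((2 : ℝ) ^ (3 * (s + s + k))) * Real.sqrt ((2 : ℝ) ^ (3 * (s + s + k))) =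
        ((2 : ℝ) ^ s * 2 ^ s * 2 ^ k) ^ 3 := by
      rw [Real.mul_self_sqrt hM0]
      ring
    nlinarith [hsq, hM]
  -- Parseval and Cauchy–Schwarz
  have hVs : ∑ a : Fin s → Bool, ∑ c : Fin k → Bool, V a c ^ 2 = 2 ^ s * (2 ^ k * 2 ^ k) := by
    rw [sum_congr rfl fun a _ => hV a, sum_const, card_univ, Fintype.card_fun, Fintype.card_bool,
      Fintype.card_fin, nsmul_eq_mul]
    push_cast
    rfl
  have hCS : (∑ a, ∑ c, S a c * V a c) ^ 2 ≤ (∑ a, ∑ c, S a c ^ 2) * (2 ^ s * (2 ^ k * 2 ^ k)) := by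
    have h := trg_cauchy_schwarz S V
    rwa [hVs] at h
  -- the fibre bounds, summed
  have hSs : ∑ a, ∑ c, S a c ^ 2 ≤
      2 ^ s * 2 ^ k * ((2 : ℝ) ^ s * 2 ^ s) - 7 / 16 * ((2 : ℝ) ^ s * 2 ^ s) * ∑ a, ∑ c, β a c := by
    have e1 : ∑ a, ∑ c, S a c ^ 2 ≤
        ∑ a : Fin s → Bool, ∑ c : Fin k → Bool, ((2 : ℝ) ^ s * 2 ^ s - 7 / 16 * ((2 : ℝ) ^ s * 2 ^ s) * β a c) :=
      sum_le_sum fun a _ => sum_le_sum fun c _ => hS a c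
    have e2 : ∑ a : Fin s → Bool, ∑ c : Fin k → Bool, ((2 : ℝ) ^ s * 2 ^ s - 7 / 16 * ((2 : ℝ) ^ s * 2 ^ s) * β a c) =
        2 ^ s * 2 ^ k * ((2 : ℝ) ^ s * 2 ^ s) - 7 / 16 * ((2 : ℝ) ^ s * 2 ^ s) * ∑ a, ∑ c, β a c := by
      simp only [sum_sub_distrib, sum_const, card_univ, Fintype.card_fun, Fintype.card_bool, Fintype.card_fin,
        nsmul_eq_mul, mul_sum]
      push_cast
      ring
    linarith
  have hA : ∑ a, ∑ c, S a c ^ 2 ≤ 57 / 64 * ((2 : ℝ) ^ s * 2 ^ s * 2 ^ s * 2 ^ k) := by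
    nlinarith [hSs, mul_le_mul_of_nonneg_left hβ (by positivity : (0 : ℝ) ≤ 2 ^ s * 2 ^ s)]
  -- assembling
  have hX : (∑ a, ∑ c, S a c * V a c) ^ 2 ≤ 57 / 64 * ((2 : ℝ) ^ s * 2 ^ s * 2 ^ s * 2 ^ s * (2 ^ k * 2 ^ k * 2 ^ k)) := by
    nlinarith [hCS, mul_le_mul_of_nonneg_left hA (by positivity : (0 : ℝ) ≤ 2 ^ s * (2 ^ k * 2 ^ k))]
  have hT2 : T ^ 2 ≤ 57 / 64 * ((2 : ℝ) ^ s * 2 ^ s * 2 ^ k) ^ 3 := by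
    rw [hT]
    nlinarith [mul_le_mul_of_nonneg_left hX (by positivity : (0 : ℝ) ≤ 2 ^ s * 2 ^ s)]
  nlinarith [h2, hT2, pow_pos (by positivity : (0 : ℝ) < 2 ^ s * 2 ^ s * 2 ^ k) 3]

/-! ### Degree bookkeeping for the middle block -/

/-- The coordinates of `b ↦ (a ‖ b ‖ c)` have degree `≤ 1`. [cite: Carlet2020, §2.2.1 Def. 6] -/
theorem trg_deg_coord_mid (a : Fin s → Bool) (c : Fin k → Bool) (v : Fin (s + s + k)) :
    IsDegLeFun 1 (fun b : Fin s → Bool => Fin.append (Fin.append a b) c v) := by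
  induction v using Fin.addCases with
  | left i =>
    simp only [Fin.append_left]
    induction i using Fin.addCases with
    | left i' => simp only [Fin.append_left]; exact isDegLeFun_const 1 (a i')
    | right j => simp only [Fin.append_right]; exact isDegLeFun_apply j le_rfl
  | right j => simp only [Fin.append_right]; exact isDegLeFun_const 1 (c j)

/-! ### The stub -/

/-- **stub_templateRigidity** (TR, line `direct-sum-amplification`). For a template
`(-1)^{g(y′ ‖ u ‖ w)} = (-1)^{y′·u} (-1)^{G_u(w)}` (any `G`) and ANY cubic `f` with `Φ(f,g) > 31/32`, `f` is a matched
partner: `(-1)^{f(a ‖ b ‖ c)} = (-1)^{a·b} (-1)^{F_a(c)}` with `F_a(c) = f(a ‖ 0 ‖ c)`. Localisation + Cauchy–Schwarz +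
Parseval give `Φ² ≤ E_{a,c} (S(a,c)/2^s)²`; a non-constant cubic fibre has `(S/2^s)² ≤ 9/16` (Reed–Muller); a
non-vanishing `b`-derivative `ψᵢ = f ⊕ f(· ⊕ eᵢ) ⊕ aᵢ` (degree `≤ 2`) makes `≥ 1/4` of the fibres non-constant, forcing
`Φ² ≤ 57/64 < (31/32)²`; so all `ψᵢ ≡ 0` and every fibre `b ↦ f(a ‖ b ‖ c) ⊕ a·b` is constant. [folklore] -/
theorem stub_templateRigidity :
    ∀ (s k : ℕ) (f g : (Fin (s + s + k) → Bool) → Bool) (G : (Fin s → Bool) → (Fin k → Bool) → Bool),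
      (∀ (y u : Fin s → Bool) (w : Fin k → Bool),
          signOf (g (Fin.append (Fin.append y u) w)) = twist y u * signOf (G u w)) →
      IsDegLeFun 3 f → 31 / 32 < forrelation f g →
      ∃ F : (Fin s → Bool) → (Fin k → Bool) → Bool, ∀ (a b : Fin s → Bool) (c : Fin k → Bool),
        signOf (f (Fin.append (Fin.append a b) c)) = twist a b * signOf (F a c) := by
  intro s k f g G hg hf hΦ
  have hR := stub_rmWeight stub_derivDegree
  obtain ⟨l, hl1, hl⟩ := fc_linForm_exists s
  -- flip directions of the middle block, the `b`-derivatives `ψᵢ`, the fibre functions `q a c`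
  obtain ⟨T, hT⟩ : ∃ T : Fin s → Fin (s + s + k) → Bool,
      ∀ i, T i = Fin.append (Fin.append (zeroVec : Fin s → Bool) (Pi.single i true)) (zeroVec : Fin k → Bool) :=
    ⟨_, fun _ => rfl⟩
  obtain ⟨ψ, hψ⟩ : ∃ ψ : Fin s → (Fin (s + s + k) → Bool) → Bool,
      ∀ i x, ψ i x = ((f x ^^ f (bxor x (T i))) ^^ x (Fin.castAdd k (Fin.castAdd s i))) :=
    ⟨fun i x => (f x ^^ f (bxor x (T i))) ^^ x (Fin.castAdd k (Fin.castAdd s i)), fun _ _ => rfl⟩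
  obtain ⟨q, hq⟩ : ∃ q : (Fin s → Bool) → (Fin k → Bool) → (Fin s → Bool) → Bool,
      ∀ a c b, q a c b = (f (Fin.append (Fin.append a b) c) ^^ l a b) := ⟨_, fun _ _ _ => rfl⟩
  have hψdeg : ∀ i, IsDegLeFun 2 (ψ i) := fun i => by
    rw [show ψ i = fun x => ((f x ^^ f (bxor x (T i))) ^^ x (Fin.castAdd k (Fin.castAdd s i))) from funext (hψ i)]
    exact fc_deg_bxor (stub_derivDegree (s + s + k) 2 f (T i) hf) (isDegLeFun_apply _ (by norm_num))
  have hqdeg : ∀ a c, IsDegLeFun 3 (q a c) := fun a c => by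
    rw [show q a c = fun b => (f (Fin.append (Fin.append a b) c) ^^ l a b) from funext (hq a c)]
    exact fc_deg_bxor (fc_isDegLeFun_comp hf (fun b => Fin.append (Fin.append a b) c) (trg_deg_coord_mid a c)
      (by norm_num)) ((hl1 a).mono (by norm_num))
  have hshift : ∀ (a b : Fin s → Bool) (c : Fin k → Bool) (i : Fin s),
      bxor (Fin.append (Fin.append a b) c) (T i) = Fin.append (Fin.append a (bxor b (Pi.single i true))) c := by
    intro a b c i
    rw [hT, fc_bxor_append, fc_bxor_append, bxor_zeroVec, bxor_zeroVec]
  have hcoord : ∀ (a b : Fin s → Bool) (c : Fin k → Bool) (i : Fin s),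
      Fin.append (Fin.append a b) c (Fin.castAdd k (Fin.castAdd s i)) = a i := by
    intro a b c i
    rw [Fin.append_left, Fin.append_left]
  -- the coordinate derivatives of the fibre functions are the `ψᵢ`
  have hderiv : ∀ (a : Fin s → Bool) (c : Fin k → Bool) (i : Fin s) (b : Fin s → Bool),
      (q a c b ^^ q a c (bxor b (Pi.single i true))) = ψ i (Fin.append (Fin.append a b) c) := by
    intro a c i b
    rw [hq, hq, (fc_lin_props (hl a)).1, (fc_lin_props (hl a)).2.1, hψ, hshift, hcoord]
    exact fc_bool_id1 _ _ _ _
  -- signs of the fibre functions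
  have hqsign : ∀ (a : Fin s → Bool) (c : Fin k → Bool) (b : Fin s → Bool),
      signOf (q a c b) = signOf (f (Fin.append (Fin.append a b) c)) * twist b a := by
    intro a c b
    rw [hq, signOf_xor, hl]
  by_cases hZ : ∃ i x, ψ i x = true
  · -- some `b`-derivative does not vanish: contradiction with `Φ > 31/32`
    exfalso
    obtain ⟨i, x₀, hx₀⟩ := hZ
    obtain ⟨β, hβ⟩ : ∃ β : (Fin s → Bool) → (Fin k → Bool) → ℝ, ∀ a c,
        β a c = if ∃ b : Fin s → Bool, ψ i (Fin.append (Fin.append a b) c) = true then 1 else 0 :=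
      ⟨_, fun _ _ => rfl⟩
    have hβ1 : ∀ (a b : Fin s → Bool) (c : Fin k → Bool),
        ψ i (Fin.append (Fin.append a b) c) = true → (1 : ℝ) ≤ β a c := by
      intro a b c h
      rw [hβ, if_pos ⟨b, h⟩]
    have hβ0 : ∀ a c, 0 ≤ β a c := by
      intro a c
      rw [hβ]
      split_ifs <;> norm_num
    -- at least a quarter of the fibres are bad
    have hRψ := (Nat.cast_le (α := ℝ)).2 (hR (s + s + k) 2 (ψ i) (hψdeg i) ⟨x₀, hx₀⟩)
    push_cast at hRψ
    have hcnt := trg_count (ψ i) β hβ1 hβ0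
    have hP : (0 : ℝ) < 2 ^ s := by positivity
    have hβsum : (2 : ℝ) ^ s * (2 : ℝ) ^ k ≤ 4 * ∑ a, ∑ c, β a c := by
      refine le_of_mul_le_mul_left ?_ hP
      have h2 : (2 : ℝ) ^ (s + s + k) = 2 ^ s * (2 ^ s * 2 ^ k) := by rw [pow_add, pow_add]; ring
      rw [h2] at hRψ
      calc (2 : ℝ) ^ s * (2 ^ s * 2 ^ k) ≤ 4 * ((univ.filter fun x => ψ i x = true).card : ℝ) := hRψ
        _ ≤ 4 * ((2 : ℝ) ^ s * ∑ a, ∑ c, β a c) := by gcongr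
        _ = 2 ^ s * (4 * ∑ a, ∑ c, β a c) := by ring
    -- the two sums of the localisation
    obtain ⟨S, hS⟩ : ∃ S : (Fin s → Bool) → (Fin k → Bool) → ℝ,
        ∀ a c, S a c = ∑ b : Fin s → Bool, signOf (f (Fin.append (Fin.append a b) c)) * twist b a :=
      ⟨_, fun _ _ => rfl⟩
    obtain ⟨V, hV⟩ : ∃ V : (Fin s → Bool) → (Fin k → Bool) → ℝ,
        ∀ a c, V a c = ∑ w : Fin k → Bool, twist c w * signOf (G a w) := ⟨_, fun _ _ => rfl⟩
    have hSq : ∀ a c, S a c = ∑ b, signOf (q a c b) := by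
      intro a c
      rw [hS]
      exact sum_congr rfl fun b _ => (hqsign a c b).symm
    have hSbd : ∀ a c, S a c ^ 2 ≤ (2 : ℝ) ^ s * (2 : ℝ) ^ s - 7 / 16 * ((2 : ℝ) ^ s * (2 : ℝ) ^ s) * β a c := by
      intro a c
      rw [hSq, hβ]
      split_ifs with hex
      · obtain ⟨b, hb⟩ := hex
        obtain ⟨h1, h0⟩ := trg_both_of_xor _ _ ((hderiv a c i b).trans hb)
        have h := trg_sq_le_of_nonconst hR (hqdeg a c) (by rcases h1 with h | h <;> exact ⟨_, h⟩)
          (by rcases h0 with h | h <;> exact ⟨_, h⟩)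
        linarith
      · have h := trg_sq_le (q a c)
        linarith
    have hVa : ∀ a, ∑ c, V a c ^ 2 = (2 : ℝ) ^ k * (2 : ℝ) ^ k := by
      intro a
      rw [sum_congr rfl fun c _ => by rw [hV a c]]
      exact trg_parseval G a
    unfold forrelation at hΦ
    exact trg_core S V β _ hVa hSbd hβsum (trg_fsum f g G hg S V hS hV) hΦ
  · -- every `b`-derivative vanishes: each fibre function is constant, which is the matched form
    simp only [not_exists, Bool.not_eq_true] at hZ
    refine ⟨fun a c => f (Fin.append (Fin.append a zeroVec) c), fun a b c => ?_⟩
    have hc : q a c b = q a c zeroVec :=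
      fc_const_of_shift (q a c) (fun i b => fc_bool_xor_eq_false _ _ ((hderiv a c i b).trans (hZ i _))) b
    have h0 : signOf (q a c zeroVec) = signOf (f (Fin.append (Fin.append a zeroVec) c)) := by
      rw [hq, (fc_lin_props (hl a)).2.2, Bool.xor_false]
    calc signOf (f (Fin.append (Fin.append a b) c))
        = signOf (f (Fin.append (Fin.append a b) c)) * twist b a * twist b a := by
          rw [mul_assoc, Simon.twist_mul_self, mul_one]
      _ = signOf (q a c b) * twist b a := by rw [hqsign]
      _ = twist a b * signOf (f (Fin.append (Fin.append a zeroVec) c)) := by rw [hc, h0, twist_comm, mul_comm]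

end Summit.QuantumAdvantage.QuantumAdvantage.Theorems.CubicForrelation.NearExactIsExact

end
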